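import Summits.QuantumFields.YangMills.Theorems.SwapVirialDeficitSectorLaplaceBTubeHubCot
import Summits.QuantumFields.YangMills.Theorems.SwapVirialDeficitSectorLaplaceChartMeasure
import Summits.QuantumFields.YangMills.Theorems.SwapVirialDeficitSectorLaplaceBTubeCapHubCot
import HarnessLib

/-!
# THE END-HUB INTEGRALS IN THE LETTERS `(δ, η)` — the left side of `stub_core_end` read against `μ_B` (twin of ✓`setLIntegral_BTube_eq_hubCot` WITHOUT the tube constraint)
# (free-hands support of ⟨stmt-QuantumFields-24197⟩ `SwapVirialDeficit.SwapGluedStiffness`; LEAD g99 memo10 (E1): the END-CORE weight of skeleton ➎ is bounded on the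
# LARGER region `EndHub τ ×ˢ univ` (ruling: drop `∖ BTubeCap` — the tubes are `b^{−1/2}`-negligible), so its reading needs only the hub window)

For `im a ≠ 0` the end-hub condition is a condition on the hub-polar letter `δ = re a/‖im a‖` alone (✓`hubS1_eq_cot`, ✓`hubS2_eq_cot`):
`a ∈ EndHub τ ↔ 4δ²/(1+δ²)² < τ ∧ τ ≤ (1+δ²)⁻¹` (§1), and the real axis is cone-null (✓`ae_im_ne_zero_chartMeasure`); hence (§2), for every measurable `g : ℝ → ℝ≥0∞`,
★★ `setLIntegral_endHub_eq_hubCot`: `∫⁻_{EndHub τ ×ˢ univ} g(F̂(a,ε,η)) d(chartMeasure) = coneConst·π · ∫⁻_{{δ : 4δ²/(1+δ²)² < τ ≤ (1+δ²)⁻¹} × GnoCoord} g(F̂(hubAt δ 1, ε, η)) dμ_B`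
(✓`lintegral_chartMeasure_hubCot_muB`, ✓`gnoDeficit_eq_hubCot`), and the Bochner form ★ `setIntegral_endHub_exp_eq_hubCot` for `e^{−bF̂}` (the integrand of
`stub_core_end`).  §3 (appended after the LEAD's retraction memo10a): the TRUE end-core region of ➎ v8, `(EndHub τ ×ˢ univ) ∖ BTubeCap L τ X₁`, read in letters as
`{end window} ∖ RgCap` with `RgCap` the capped window-cylinder of ✓`bTubeCap_stiff_of_farFloor` (★★ `setLIntegral_endCore_eq_hubCot`, ★ `setIntegral_endCore_exp_eq_hubCot`).  With ✓`gnoDeficit_hubAt_ge_sigma_product` (the pointwise floor) and ✓`…SigmaBallModel` (u first) this is the entry point of memo10 §2.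

HONEST LABEL: measure bookkeeping; stubs B ∕ core-tip ∕ core-end ∕ 001-good of skeleton ➎ OPEN, ⟨24197⟩ ∕ ⟨24194⟩ ∕ ⟨24497⟩ OPEN; own crux ⟨22884⟩
`LargeFieldMassRefinementTail` OPEN (blocked-on ⟨19935⟩); the Yang–Mills mass gap is NOT proved; no summit is proved by a line.  THEOREMS ONLY (0 `def`, 0 `sorry`),
standard axioms; the series' local `ℍ` instances.  LEAD seat ym-line-sfw-p2 g99 (cell ym-idea-1, free hands), `--supports stmt-QuantumFields-24197`.  References: [folklore].
-/

set_option autoImplicit false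
set_option synthInstance.maxSize 1024

noncomputable section

open MeasureTheory Quaternion Set
open scoped Quaternion ENNReal BigOperators
open Literature.MathematicalPhysics.QuantumLattice
open Literature.MathematicalPhysics.QuantumFieldTheory hiding SU2
open Summit.QuantumFields.YangMills.Theorems.SwapTwistDeficit.ToronLog

attribute [local instance] Literature.Analysis.FluidPDE.Tao2016.quatMeasurableSpace
  Literature.Analysis.FluidPDE.Tao2016.quatBorelSpace
  Literature.MathematicalPhysics.QuantumLattice.secondCountableTopology_su2

namespace Summit.QuantumFields.YangMills.Theorems.SwapVirialDeficit.BlowUpRing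

open Summit.QuantumFields.YangMills.Theorems.FemtoTransferGap
open Summit.QuantumFields.YangMills.Theorems.FemtoTransferGap.TT
open Summit.QuantumFields.YangMills.Theorems.VirialFluxGap.RingDeficit
open Summit.QuantumFields.YangMills.Theorems.SwapVirialDeficit.SectorLaplace

variable {L : ℕ} [NeZero L]

/-! ## §1 The end hubs in the letter `δ` -/

omit [NeZero L] in
/-- ★ **THE END HUBS IN THE LETTER `δ = re a/‖im a‖`**: for `im a ≠ 0`, `(a, η) ∈ EndHub τ ×ˢ univ ↔ 4δ²/(1+δ²)² < τ ∧ τ ≤ (1+δ²)⁻¹`. [folklore] -/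
theorem mem_endHub_prod_iff_cot {a : ℍ} (him : a.im ≠ 0) (η : GnoCoord L) (τ : ℝ) :
    (a, η) ∈ EndHub τ ×ˢ (univ : Set (GnoCoord L)) ↔
      4 * (a.re / ‖a.im‖) ^ 2 / (1 + (a.re / ‖a.im‖) ^ 2) ^ 2 < τ ∧ τ ≤ (1 + (a.re / ‖a.im‖) ^ 2)⁻¹ := by
  simp only [mem_prod, mem_univ, and_true, EndHub, mem_setOf_eq]
  rw [hubS1_eq_cot him, hubS2_eq_cot him]

omit [NeZero L] in
/-- The end window `{(δ, η) | 4δ²/(1+δ²)² < τ ≤ (1+δ²)⁻¹}` is measurable. [folklore] -/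
theorem measurableSet_endWindow (τ : ℝ) :
    MeasurableSet {p : ℝ × GnoCoord L | 4 * p.1 ^ 2 / (1 + p.1 ^ 2) ^ 2 < τ ∧ τ ≤ (1 + p.1 ^ 2)⁻¹} := by
  have h1 : Measurable fun p : ℝ × GnoCoord L => p.1 := measurable_fst
  have ha : Measurable fun p : ℝ × GnoCoord L => 4 * p.1 ^ 2 / (1 + p.1 ^ 2) ^ 2 :=
    ((h1.pow_const 2).const_mul 4).div ((measurable_const.add (h1.pow_const 2)).pow_const 2)
  have hb : Measurable fun p : ℝ × GnoCoord L => (1 + p.1 ^ 2)⁻¹ := (measurable_const.add (h1.pow_const 2)).inv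
  exact (measurableSet_lt ha measurable_const).inter (measurableSet_le measurable_const hb)

omit [NeZero L] in
/-- `EndHub τ ×ˢ univ` is measurable. [folklore] -/
theorem measurableSet_endHub_prod (τ : ℝ) : MeasurableSet (EndHub τ ×ˢ (univ : Set (GnoCoord L))) :=
  (measurableSet_endHub τ).prod MeasurableSet.univ

/-! ## §2 The end-hub integrals as window integrals against `μ_B` -/

/-- ★★ **THE END-HUB INTEGRALS IN THE LETTERS `(δ, η)`**: for every measurable `g : ℝ → ℝ≥0∞`, sector `z`, character `χ`, signs `ε` and cut `τ`,
`∫⁻_{EndHub τ ×ˢ univ} g(F̂(a, ε, η)) d(chartMeasure) = coneConst·π · ∫⁻_{{4δ²/(1+δ²)² < τ ≤ (1+δ²)⁻¹}} g(F̂(hubAt δ 1, ε, η)) dμ_B(δ, η)`. [folklore] -/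
theorem setLIntegral_endHub_eq_hubCot (z : Fin 3 → Bool) (χ : Site 3 L → SU2) (ε : GnoSign L) (τ : ℝ) (g : ℝ → ℝ≥0∞) (hg : Measurable g) :
    ∫⁻ x in EndHub τ ×ˢ (univ : Set (GnoCoord L)), g (gnoDeficit z χ x.1 ε x.2) ∂(chartMeasure L) =
      ENNReal.ofReal (coneConst * Real.pi) *
        ∫⁻ p in {p : ℝ × GnoCoord L | 4 * p.1 ^ 2 / (1 + p.1 ^ 2) ^ 2 < τ ∧ τ ≤ (1 + p.1 ^ 2)⁻¹},
          g (gnoDeficit z χ (hubAt p.1 1) ε p.2)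
          ∂((volume : Measure (ℝ × GnoCoord L)).withDensity fun p => ENNReal.ofReal (((1 + p.1 ^ 2)⁻¹) ^ 2 * gnoDensity p.2)) := by
  set Rg : Set (ℝ × GnoCoord L) := {p : ℝ × GnoCoord L | 4 * p.1 ^ 2 / (1 + p.1 ^ 2) ^ 2 < τ ∧ τ ≤ (1 + p.1 ^ 2)⁻¹} with hRg
  have hRgm : MeasurableSet Rg := measurableSet_endWindow τ
  set H : ℝ × GnoCoord L → ℝ≥0∞ := Rg.indicator fun p => g (gnoDeficit z χ (hubAt p.1 1) ε p.2) with hHdef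
  have hHm : Measurable H := (hg.comp (measurable_bDeficit z χ ε)).indicator hRgm
  rw [← lintegral_indicator (measurableSet_endHub_prod τ), ← lintegral_indicator hRgm]
  have hae : (fun x : ℍ × GnoCoord L => (EndHub τ ×ˢ (univ : Set (GnoCoord L))).indicator (fun x => g (gnoDeficit z χ x.1 ε x.2)) x) =ᵐ[chartMeasure L]
      fun x : ℍ × GnoCoord L => H (x.1.re / ‖x.1.im‖, x.2) := by
    filter_upwards [ae_im_ne_zero_chartMeasure (L := L)] with x him
    have hmem : x ∈ EndHub τ ×ˢ (univ : Set (GnoCoord L)) ↔ (x.1.re / ‖x.1.im‖, x.2) ∈ Rg := by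
      rw [hRg, show x = (x.1, x.2) from rfl, mem_endHub_prod_iff_cot him]
      simp only [mem_setOf_eq]
    by_cases hx : x ∈ EndHub τ ×ˢ (univ : Set (GnoCoord L))
    · rw [indicator_of_mem hx, hHdef, indicator_of_mem (hmem.1 hx), gnoDeficit_eq_hubCot z χ him]
    · rw [indicator_of_notMem hx, hHdef, indicator_of_notMem (fun h => hx (hmem.2 h))]
  rw [lintegral_congr_ae hae, lintegral_chartMeasure_hubCot_muB H hHm]

/-- ★ **THE END-HUB WEIGHT IN THE LETTERS `(δ, η)`** (the left side of `stub_core_end` on the enlarged region, memo10 §0):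
`∫_{EndHub τ ×ˢ univ} e^{−bF̂(a,ε,η)} d(chartMeasure) = coneConst·π · ∫_{{4δ²/(1+δ²)² < τ ≤ (1+δ²)⁻¹}} e^{−bF̂(hubAt δ 1, ε, η)} dμ_B`. [folklore] -/
theorem setIntegral_endHub_exp_eq_hubCot (z : Fin 3 → Bool) (χ : Site 3 L → SU2) (ε : GnoSign L) (τ b : ℝ) :
    ∫ x in EndHub τ ×ˢ (univ : Set (GnoCoord L)), Real.exp (-(b * gnoDeficit z χ x.1 ε x.2)) ∂(chartMeasure L) =
      coneConst * Real.pi *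
        ∫ p in {p : ℝ × GnoCoord L | 4 * p.1 ^ 2 / (1 + p.1 ^ 2) ^ 2 < τ ∧ τ ≤ (1 + p.1 ^ 2)⁻¹},
          Real.exp (-(b * gnoDeficit z χ (hubAt p.1 1) ε p.2))
          ∂((volume : Measure (ℝ × GnoCoord L)).withDensity fun p => ENNReal.ofReal (((1 + p.1 ^ 2)⁻¹) ^ 2 * gnoDensity p.2)) := by
  have hm1 : Measurable fun x : ℍ × GnoCoord L => Real.exp (-(b * gnoDeficit z χ x.1 ε x.2)) :=
    ((measurable_gnoDeficit_uncurry z χ ε).const_mul b).neg.exp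
  have hm2 : Measurable fun p : ℝ × GnoCoord L => Real.exp (-(b * gnoDeficit z χ (hubAt p.1 1) ε p.2)) :=
    ((measurable_bDeficit z χ ε).const_mul b).neg.exp
  rw [integral_eq_lintegral_of_nonneg_ae (Filter.Eventually.of_forall fun x => (Real.exp_pos _).le) hm1.aestronglyMeasurable.restrict,
    integral_eq_lintegral_of_nonneg_ae (Filter.Eventually.of_forall fun x => (Real.exp_pos _).le) hm2.aestronglyMeasurable.restrict]
  have h := setLIntegral_endHub_eq_hubCot z χ ε τ (fun t => ENNReal.ofReal (Real.exp (-(b * t)))) (by fun_prop)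
  rw [h, ENNReal.toReal_mul, ENNReal.toReal_ofReal (mul_pos coneConst_pos Real.pi_pos).le]

/-- The end-core integral on `(EndHub τ ×ˢ univ) ∖ S` is at most the full end-hub integral (integrand `≥ 0`, `b ≥ 0`) — the reduction of `stub_core_end` to the enlarged
region (memo10 §0). [folklore] -/
theorem setIntegral_endCore_le_endHub (z : Fin 3 → Bool) (χ : Site 3 L → SU2) (ε : GnoSign L) (τ : ℝ) {b : ℝ} (hb : 0 ≤ b) (S : Set (ℍ × GnoCoord L)) :
    ∫ x in (EndHub τ ×ˢ (univ : Set (GnoCoord L))) \ S, Real.exp (-(b * gnoDeficit z χ x.1 ε x.2)) ∂(chartMeasure L) ≤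
      ∫ x in EndHub τ ×ˢ (univ : Set (GnoCoord L)), Real.exp (-(b * gnoDeficit z χ x.1 ε x.2)) ∂(chartMeasure L) := by
  have hm1 : Measurable fun x : ℍ × GnoCoord L => Real.exp (-(b * gnoDeficit z χ x.1 ε x.2)) :=
    ((measurable_gnoDeficit_uncurry z χ ε).const_mul b).neg.exp
  have hint : IntegrableOn (fun x : ℍ × GnoCoord L => Real.exp (-(b * gnoDeficit z χ x.1 ε x.2))) (EndHub τ ×ˢ (univ : Set (GnoCoord L))) (chartMeasure L) := by
    refine Integrable.integrableOn (integrable_chartMeasure_of_bounded hm1 (M := 1) fun x => ?_)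
    rw [abs_of_pos (Real.exp_pos _), Real.exp_le_one_iff, neg_nonpos]
    exact mul_nonneg hb (gnoDeficit_nonneg _ _ _ _ _)
  exact setIntegral_mono_set hint (Filter.Eventually.of_forall fun x => (Real.exp_pos _).le) (Filter.Eventually.of_forall Set.sdiff_subset)


/-! ## §3 (appended) The true end core `(EndHub τ ×ˢ univ) ∖ BTubeCap L τ X₁` in the letters `(δ, η)` -/

omit [NeZero L] in
/-- The end core of skeleton ➎ is measurable. [folklore] -/
theorem measurableSet_endCore (τ X₁ : ℝ) : MeasurableSet ((EndHub τ ×ˢ (univ : Set (GnoCoord L))) \ BTubeCap L τ X₁) :=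
  (measurableSet_endHub_prod τ).diff (measurableSet_BTubeCap τ X₁)

/-- ★★ **THE END CORE IN THE LETTERS `(δ, η)`**: for every measurable `g : ℝ → ℝ≥0∞`,
`∫⁻_{(EndHub τ ×ˢ univ) ∖ BTubeCap L τ X₁} g(F̂(a,ε,η)) d(chartMeasure) = coneConst·π · ∫⁻_{{end window} ∖ RgCap} g(F̂(hubAt δ 1, ε, η)) dμ_B(δ, η)`, where
`RgCap = {δ ∈ W_τ} ∩ {τ ≤ √(η_x1²+η_x2²)} ∩ {|η_x0| ≤ X₁√(1+η_x1²+η_x2²)}` is the region of ✓`bTubeCap_stiff_of_farFloor`. [folklore] -/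
theorem setLIntegral_endCore_eq_hubCot (z : Fin 3 → Bool) (χ : Site 3 L → SU2) (ε : GnoSign L) (τ X₁ : ℝ) (g : ℝ → ℝ≥0∞) (hg : Measurable g) :
    ∫⁻ x in (EndHub τ ×ˢ (univ : Set (GnoCoord L))) \ BTubeCap L τ X₁, g (gnoDeficit z χ x.1 ε x.2) ∂(chartMeasure L) =
      ENNReal.ofReal (coneConst * Real.pi) *
        ∫⁻ p in {p : ℝ × GnoCoord L | 4 * p.1 ^ 2 / (1 + p.1 ^ 2) ^ 2 < τ ∧ τ ≤ (1 + p.1 ^ 2)⁻¹} \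
            ({p : ℝ × GnoCoord L | 4 * p.1 ^ 2 / (1 + p.1 ^ 2) ^ 2 < τ ∧ τ ≤ (1 + p.1 ^ 2)⁻¹ ∧ |p.1| < τ * Real.sqrt (1 + p.1 ^ 2)} ∩
              {p : ℝ × GnoCoord L | τ ≤ Real.sqrt (p.2.1.1 1 ^ 2 + p.2.1.1 2 ^ 2)} ∩
              {p : ℝ × GnoCoord L | |p.2.1.1 0| ≤ X₁ * Real.sqrt (1 + p.2.1.1 1 ^ 2 + p.2.1.1 2 ^ 2)}),
          g (gnoDeficit z χ (hubAt p.1 1) ε p.2)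
          ∂((volume : Measure (ℝ × GnoCoord L)).withDensity fun p => ENNReal.ofReal (((1 + p.1 ^ 2)⁻¹) ^ 2 * gnoDensity p.2)) := by
  set EW : Set (ℝ × GnoCoord L) := {p : ℝ × GnoCoord L | 4 * p.1 ^ 2 / (1 + p.1 ^ 2) ^ 2 < τ ∧ τ ≤ (1 + p.1 ^ 2)⁻¹} with hEW
  set RC : Set (ℝ × GnoCoord L) :=
    {p : ℝ × GnoCoord L | 4 * p.1 ^ 2 / (1 + p.1 ^ 2) ^ 2 < τ ∧ τ ≤ (1 + p.1 ^ 2)⁻¹ ∧ |p.1| < τ * Real.sqrt (1 + p.1 ^ 2)} ∩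
      {p : ℝ × GnoCoord L | τ ≤ Real.sqrt (p.2.1.1 1 ^ 2 + p.2.1.1 2 ^ 2)} ∩
      {p : ℝ × GnoCoord L | |p.2.1.1 0| ≤ X₁ * Real.sqrt (1 + p.2.1.1 1 ^ 2 + p.2.1.1 2 ^ 2)} with hRC
  have hRgm : MeasurableSet (EW \ RC) := (measurableSet_endWindow τ).diff (measurableSet_bCapRegion τ X₁)
  set H : ℝ × GnoCoord L → ℝ≥0∞ := (EW \ RC).indicator fun p => g (gnoDeficit z χ (hubAt p.1 1) ε p.2) with hHdef
  have hHm : Measurable H := (hg.comp (measurable_bDeficit z χ ε)).indicator hRgm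
  rw [← lintegral_indicator (measurableSet_endCore τ X₁), ← lintegral_indicator hRgm]
  have hae : (fun x : ℍ × GnoCoord L => ((EndHub τ ×ˢ (univ : Set (GnoCoord L))) \ BTubeCap L τ X₁).indicator
        (fun x => g (gnoDeficit z χ x.1 ε x.2)) x) =ᵐ[chartMeasure L]
      fun x : ℍ × GnoCoord L => H (x.1.re / ‖x.1.im‖, x.2) := by
    filter_upwards [ae_im_ne_zero_chartMeasure (L := L)] with x him
    have hmem : x ∈ (EndHub τ ×ˢ (univ : Set (GnoCoord L))) \ BTubeCap L τ X₁ ↔ (x.1.re / ‖x.1.im‖, x.2) ∈ EW \ RC := by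
      rw [Set.mem_sdiff, Set.mem_sdiff, hEW, hRC, show x = (x.1, x.2) from rfl, mem_endHub_prod_iff_cot him, mem_BTubeCap_iff_cot him]
      simp only [mem_setOf_eq, mem_inter_iff]
    by_cases hx : x ∈ (EndHub τ ×ˢ (univ : Set (GnoCoord L))) \ BTubeCap L τ X₁
    · rw [indicator_of_mem hx, hHdef, indicator_of_mem (hmem.1 hx), gnoDeficit_eq_hubCot z χ him]
    · rw [indicator_of_notMem hx, hHdef, indicator_of_notMem (fun h => hx (hmem.2 h))]
  rw [lintegral_congr_ae hae, lintegral_chartMeasure_hubCot_muB H hHm]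

/-- ★ **THE END-CORE WEIGHT IN THE LETTERS `(δ, η)`** (the left side of `stub_core_end` of ➎ v8, per sign pattern):
`∫_{(EndHub τ ×ˢ univ) ∖ BTubeCap} e^{−bF̂} d(chartMeasure) = coneConst·π · ∫_{{end window} ∖ RgCap} e^{−bF̂(hubAt δ 1, ε, η)} dμ_B`. [folklore] -/
theorem setIntegral_endCore_exp_eq_hubCot (z : Fin 3 → Bool) (χ : Site 3 L → SU2) (ε : GnoSign L) (τ X₁ b : ℝ) :
    ∫ x in (EndHub τ ×ˢ (univ : Set (GnoCoord L))) \ BTubeCap L τ X₁, Real.exp (-(b * gnoDeficit z χ x.1 ε x.2)) ∂(chartMeasure L) =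
      coneConst * Real.pi *
        ∫ p in {p : ℝ × GnoCoord L | 4 * p.1 ^ 2 / (1 + p.1 ^ 2) ^ 2 < τ ∧ τ ≤ (1 + p.1 ^ 2)⁻¹} \
            ({p : ℝ × GnoCoord L | 4 * p.1 ^ 2 / (1 + p.1 ^ 2) ^ 2 < τ ∧ τ ≤ (1 + p.1 ^ 2)⁻¹ ∧ |p.1| < τ * Real.sqrt (1 + p.1 ^ 2)} ∩
              {p : ℝ × GnoCoord L | τ ≤ Real.sqrt (p.2.1.1 1 ^ 2 + p.2.1.1 2 ^ 2)} ∩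
              {p : ℝ × GnoCoord L | |p.2.1.1 0| ≤ X₁ * Real.sqrt (1 + p.2.1.1 1 ^ 2 + p.2.1.1 2 ^ 2)}),
          Real.exp (-(b * gnoDeficit z χ (hubAt p.1 1) ε p.2))
          ∂((volume : Measure (ℝ × GnoCoord L)).withDensity fun p => ENNReal.ofReal (((1 + p.1 ^ 2)⁻¹) ^ 2 * gnoDensity p.2)) := by
  have hm1 : Measurable fun x : ℍ × GnoCoord L => Real.exp (-(b * gnoDeficit z χ x.1 ε x.2)) :=
    ((measurable_gnoDeficit_uncurry z χ ε).const_mul b).neg.exp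
  have hm2 : Measurable fun p : ℝ × GnoCoord L => Real.exp (-(b * gnoDeficit z χ (hubAt p.1 1) ε p.2)) :=
    ((measurable_bDeficit z χ ε).const_mul b).neg.exp
  rw [integral_eq_lintegral_of_nonneg_ae (Filter.Eventually.of_forall fun x => (Real.exp_pos _).le) hm1.aestronglyMeasurable.restrict,
    integral_eq_lintegral_of_nonneg_ae (Filter.Eventually.of_forall fun x => (Real.exp_pos _).le) hm2.aestronglyMeasurable.restrict]
  have h := setLIntegral_endCore_eq_hubCot z χ ε τ X₁ (fun t => ENNReal.ofReal (Real.exp (-(b * t)))) (by fun_prop)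
  rw [h, ENNReal.toReal_mul, ENNReal.toReal_ofReal (mul_pos coneConst_pos Real.pi_pos).le]

end Summit.QuantumFields.YangMills.Theorems.SwapVirialDeficit.BlowUpRing

end
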